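import Literature.Analysis.FunctionSpaces.WightmanGNS
import Literature.Analysis.FunctionSpaces.SchwartzParametric
import Literature.MathematicalPhysics.QuantumLattice.SchwartzTranslationCutoff
import Literature.MathematicalPhysics.QuantumLattice.SchwingerOSPositivity
import Mathlib.Topology.UniformSpace.UniformApproximation
import HarnessLib

/-!
# Continuity properties of the GNS (Wightman reconstruction) data

Streater–Wightman (1964), §3-4, proof of Thm. 3-7, continuity clauses: the reconstructed
representation `U(a, Λ)` is strongly continuous and the reconstructed fields are tempered
(`f ↦ ⟪χ, φ(f) ψ⟫` continuous on `𝒮`), because the `𝒲ₙ` are tempered distributions and the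
Poincaré group acts continuously on `𝒮((ℝ^{1+d})^n)`.

Generic Schwartz-space inputs are imported: continuity of translations `a ↦ f(· - a)`
(`Literature.MathematicalPhysics.QuantumLattice.continuous_compSubConstCLM`, `SchwartzTranslationCutoff`), continuity of
`A ↦ f ∘ A` along operator-norm continuous families of linear automorphisms
(`SchwartzMap.continuous_compCLMOfContinuousLinearEquiv_apply`, `SchwartzParametric`), and the
Leibniz estimate for tensor products with its explicit constant (`SchwartzMap.decay_mul_comp_le`,
`SchwartzMap.mulCompBound`, `SchwingerOSPositivity`), from which `SchwartzMap.mulCompCLM`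
("tensoring with a fixed Schwartz function is a continuous linear map") is assembled here by
`SchwartzMap.mkCLM`.

Consequences for the GNS data (`WightmanFamily.GNSSpace`): continuity of the letterwise
Poincaré action on the seminormed free space (`continuous_act`), strong continuity on the
Hilbert space by density and isometry (`continuous_U_apply`, `continuous_transl_apply`,
`continuous_lor_apply`; inversion on the restricted Lorentz group is continuous by
`NormedRing.inverse_continuousAt`), and temperedness W1 (`continuous_inner_fieldOp`, through the
insertion map `insertCLM`).

## References
* R. F. Streater, A. S. Wightman, PCT, Spin and Statistics, and All That (1964), §3-4,
  Thm. 3-7.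
-/

noncomputable section

open Filter Topology ComplexConjugate
open scoped InnerProductSpace SchwartzMap ComplexOrder ContDiff

/-! ## Tensoring with a fixed Schwartz function -/

namespace SchwartzMap

/-! ### Tensoring with a fixed Schwartz function is a continuous linear map -/

section MulComp

variable {𝕜 : Type*} [RCLike 𝕜]
variable {D E₁ E₂ : Type*} [NormedAddCommGroup D] [NormedSpace ℝ D]
  [NormedAddCommGroup E₁] [NormedSpace ℝ E₁] [NormedAddCommGroup E₂] [NormedSpace ℝ E₂]

/-- **Tensoring with a fixed Schwartz function is continuous**: for fixed `g`, `π₁`, `π₂` as in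
`SchwartzMap.mulComp`, the map `f ↦ (x ↦ f(π₁ x) g(π₂ x))` is a continuous linear map
`𝒮(E₁) → 𝒮(D)` (`SchwartzMap.mkCLM` with the explicit Leibniz estimate
`SchwartzMap.decay_mul_comp_le` / `SchwartzMap.mulCompBound` of `SchwingerOSPositivity`, whose
bilinear form in the seminorms of `f` and `g` is bounded by a finite sup of seminorms of `f`). [folklore] -/
def mulCompCLM (g : 𝓢(E₂, 𝕜)) (π₁ : D →L[ℝ] E₁) (π₂ : D →L[ℝ] E₂)
    (h : ∃ C₀ : ℝ, ∀ x, ‖x‖ ≤ C₀ * max ‖π₁ x‖ ‖π₂ x‖) : 𝓢(E₁, 𝕜) →L[𝕜] 𝓢(D, 𝕜) :=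
  SchwartzMap.mkCLM (fun f x => f (π₁ x) * g (π₂ x))
    (fun f f' x => by simp [add_mul])
    (fun c f x => by simp [mul_assoc])
    (fun f => ((f.smooth ⊤).comp π₁.contDiff).mul ((g.smooth ⊤).comp π₂.contDiff))
    (by
      rintro ⟨k, n⟩
      obtain ⟨C₀, hC⟩ := h
      refine ⟨Finset.Iic (k, n), |C₀| ^ k * ∑ i ∈ Finset.range (n + 1),
        (n.choose i : ℝ) * (‖π₁‖ ^ i * ‖π₂‖ ^ (n - i)) *
          (SchwartzMap.seminorm ℝ 0 (n - i) g + SchwartzMap.seminorm ℝ k (n - i) g),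
        by positivity, fun f x => ?_⟩
      refine (decay_mul_comp_le f g π₁ π₂ hC k n x).trans ?_
      rw [mulCompBound, Finset.mul_sum, Finset.mul_sum, Finset.sum_mul]
      refine Finset.sum_le_sum fun i hi => ?_
      have hi' : i ≤ n := Nat.lt_succ_iff.1 (Finset.mem_range.1 hi)
      have hsup : ∀ {k' i' : ℕ}, k' ≤ k → i' ≤ n → SchwartzMap.seminorm ℝ k' i' f ≤
          (Finset.Iic (k, n)).sup (schwartzSeminormFamily 𝕜 E₁ 𝕜) f := fun hk' hi'' =>
        Seminorm.le_def.1 (Finset.le_sup (f := schwartzSeminormFamily 𝕜 E₁ 𝕜)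
          (Finset.mem_Iic.2 (Prod.mk_le_mk.2 ⟨hk', hi''⟩))) f
      have hki := hsup le_rfl hi'
      have h0i := hsup (Nat.zero_le _) hi'
      have hg0 : 0 ≤ SchwartzMap.seminorm ℝ 0 (n - i) g := apply_nonneg _ _
      have hgk : 0 ≤ SchwartzMap.seminorm ℝ k (n - i) g := apply_nonneg _ _
      calc |C₀| ^ k * ((n.choose i : ℝ) * (‖π₁‖ ^ i * ‖π₂‖ ^ (n - i)) *
            (SchwartzMap.seminorm ℝ k i f * SchwartzMap.seminorm ℝ 0 (n - i) g +
              SchwartzMap.seminorm ℝ 0 i f * SchwartzMap.seminorm ℝ k (n - i) g))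
          ≤ |C₀| ^ k * ((n.choose i : ℝ) * (‖π₁‖ ^ i * ‖π₂‖ ^ (n - i)) *
            ((Finset.Iic (k, n)).sup (schwartzSeminormFamily 𝕜 E₁ 𝕜) f *
                SchwartzMap.seminorm ℝ 0 (n - i) g +
              (Finset.Iic (k, n)).sup (schwartzSeminormFamily 𝕜 E₁ 𝕜) f *
                SchwartzMap.seminorm ℝ k (n - i) g)) := by
            gcongr
        _ = _ := by ring)

/-- Pointwise formula for `mulCompCLM`. [folklore] -/
@[simp] theorem mulCompCLM_apply (g : 𝓢(E₂, 𝕜)) (π₁ : D →L[ℝ] E₁) (π₂ : D →L[ℝ] E₂)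
    (h : ∃ C₀ : ℝ, ∀ x, ‖x‖ ≤ C₀ * max ‖π₁ x‖ ‖π₂ x‖) (f : 𝓢(E₁, 𝕜)) (x : D) :
    mulCompCLM g π₁ π₂ h f x = f (π₁ x) * g (π₂ x) := rfl

/-- `mulCompCLM g π₁ π₂ h f = mulComp f g π₁ π₂ h`. [folklore] -/
theorem mulCompCLM_eq_mulComp (g : 𝓢(E₂, 𝕜)) (π₁ : D →L[ℝ] E₁) (π₂ : D →L[ℝ] E₂)
    (h : ∃ C₀ : ℝ, ∀ x, ‖x‖ ≤ C₀ * max ‖π₁ x‖ ‖π₂ x‖) (f : 𝓢(E₁, 𝕜)) :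
    mulCompCLM g π₁ π₂ h f = mulComp f g π₁ π₂ h := rfl

end MulComp

end SchwartzMap

/-! ## Consequences for the GNS data -/

namespace Literature.Analysis.FunctionSpaces

namespace WightmanFamily

open Literature.MathematicalPhysics.QuantumLattice

variable {d : ℕ} {κ : Type*} (𝒲 : WightmanFamily d κ)

/-! ### Evaluation with a moving block -/

/-- A word whose first block is moved by `g`, in `Fin.append` presentation:
`𝒲(g • L ++ L') = 𝒲_{n+m}((g • ⊗L) ⊗ (⊗L'))`. [folklore] -/
theorem eval_map_append (g : PoincareGroup d) (L L' : Word d κ) :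
    eval 𝒲 (L.map (actLetter g) ++ L') =
      𝒲 (L.length + L'.length) (Fin.append (wordLab L) (wordLab L'))
        (SchwartzMap.appendTensor (poincareTestMulti L.length g (wordTensor L)) (wordTensor L')) := by
  have hlen : L.length + L'.length = (L.map (actLetter g) ++ L').length := by simp
  have hlen₁ : (L.map (actLetter g)).length + L'.length = (L.map (actLetter g) ++ L').length := by
    simp
  have hget : ∀ i : Fin (L.length + L'.length),
      (L.map (actLetter g) ++ L').get (Fin.cast hlen i) =
        Fin.append (fun j => actLetter g (L.get j)) (fun j => L'.get j) i := by
    intro i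
    refine Fin.addCases (fun j => ?_) (fun j => ?_) i
    · rw [Fin.append_left]
      have := get_append_castAdd (L.map (actLetter g)) L' hlen₁
        (Fin.cast (List.length_map _).symm j)
      simp only [List.get_eq_getElem, Fin.val_cast, Fin.val_castAdd, List.getElem_map] at this ⊢
      exact this
    · rw [Fin.append_right]
      have := get_append_natAdd (L.map (actLetter g)) L' hlen₁ j
      simp only [List.get_eq_getElem, Fin.val_cast, Fin.val_natAdd, List.length_map] at this ⊢
      exact this
  rw [eval]
  refine apply_congr 𝒲 hlen (fun i => ?_) (fun x => ?_)
  · rw [wordLab_apply, hget]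
    refine Fin.addCases (fun j => ?_) (fun j => ?_) i <;> simp
  · rw [SchwartzMap.appendTensor_apply, poincareTestMulti_apply, wordTensor_apply, wordTensor_apply,
      wordTensor_apply, prod_fin_cast hlen, Fin.prod_univ_add]
    congr 1
    · refine Finset.prod_congr rfl fun j _ => ?_
      rw [hget, Fin.append_left]
      simp [actLetter, poincareTest_apply]
    · refine Finset.prod_congr rfl fun j _ => ?_
      rw [hget, Fin.append_right]
      rfl

/-- Tensoring on the right with a fixed `n`-point test function, `T ↦ T ⊗ T'`, as a continuous
linear map (`SchwartzMap.mulCompCLM`). [folklore] -/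
def appendTensorLeftCLM {n m : ℕ} (T' : 𝓢((Fin m → SpaceTime d), ℂ)) :
    𝓢((Fin n → SpaceTime d), ℂ) →L[ℂ] 𝓢((Fin (n + m) → SpaceTime d), ℂ) :=
  SchwartzMap.mulCompCLM T' (SchwartzMap.restrictCLM (Fin.castAdd m))
    (SchwartzMap.restrictCLM (Fin.natAdd n)) ⟨1, fun x => by
      rw [one_mul, pi_norm_le_iff_of_nonneg (by positivity)]
      intro i
      induction i using Fin.addCases with
      | left j => exact (norm_le_pi_norm (x ∘ Fin.castAdd m) j).trans (le_max_left _ _)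
      | right j => exact (norm_le_pi_norm (x ∘ Fin.natAdd n) j).trans (le_max_right _ _)⟩

/-- `appendTensorLeftCLM T' T = T ⊗ T'`. [folklore] -/
@[simp] theorem appendTensorLeftCLM_apply {n m : ℕ} (T' : 𝓢((Fin m → SpaceTime d), ℂ))
    (T : 𝓢((Fin n → SpaceTime d), ℂ)) :
    appendTensorLeftCLM T' T = SchwartzMap.appendTensor T T' := rfl

/-- **Continuity of evaluation in a moving block**: if `x ↦ g(x) • T` is continuous into `𝒮`
for all multi-point test functions `T`, then `x ↦ 𝒲(g(x) • L ++ L')` is continuous. [folklore] -/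
theorem continuous_eval_map_append {X : Type*} [TopologicalSpace X] (g : X → PoincareGroup d)
    (hg : ∀ (n : ℕ) (T : 𝓢((Fin n → SpaceTime d), ℂ)), Continuous fun x => poincareTestMulti n (g x) T)
    (L L' : Word d κ) : Continuous fun x => eval 𝒲 (L.map (actLetter (g x)) ++ L') := by
  simp only [eval_map_append]
  have h1 : Continuous fun x => appendTensorLeftCLM (wordTensor L')
      (poincareTestMulti L.length (g x) (wordTensor L)) :=
    (appendTensorLeftCLM (wordTensor L')).continuous.comp (hg _ _)
  exact (𝒲 (L.length + L'.length) (Fin.append (wordLab L) (wordLab L'))).continuous.comp h1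

namespace GNSSpace

variable {𝒲} {h𝒲 : IsWightmanFamily 𝒲}

/-- **Continuity of the action on the free space**: under the hypothesis of
`continuous_eval_map_append`, `x ↦ U(g x) v` is continuous into the seminormed `GNSSpace`
(`‖U(g x) v - U(g x₀) v‖² = 2‖v‖² - 2 Re ⟪U(g x) v, U(g x₀) v⟫`). [folklore] -/
theorem continuous_act {X : Type*} [TopologicalSpace X] (g : X → PoincareGroup d)
    (hg : ∀ (n : ℕ) (T : 𝓢((Fin n → SpaceTime d), ℂ)), Continuous fun x => poincareTestMulti n (g x) T)
    (v : GNSSpace 𝒲 h𝒲) : Continuous fun x => act 𝒲 h𝒲 (g x) v := by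
  rw [← of_symm_eq v]
  set u := (of 𝒲 h𝒲).symm v
  set φ : X → GNSSpace 𝒲 h𝒲 := fun x => act 𝒲 h𝒲 (g x) (of 𝒲 h𝒲 u)
  -- the inner products `x ↦ ⟪φ x, φ x₀⟫` are continuous
  have hinner : ∀ x₀, Continuous fun x => ⟪φ x, φ x₀⟫_ℂ := by
    intro x₀
    have hform : ∀ x, ⟪φ x, φ x₀⟫_ℂ = ∑ l ∈ u.support, ∑ l' ∈ u.support,
        conj (u l) * u l' * eval 𝒲 ((WightmanData.starList l).map (actLetter (g x)) ++
          l'.map (actLetter (g x₀))) := by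
      intro x
      simp only [φ, act_of, inner_def, LinearEquiv.symm_apply_apply, innerFree_mapDomain, pairing,
        starList_map_actLetter]
    simp only [hform]
    refine continuous_finsetSum _ fun l _ => continuous_finsetSum _ fun l' _ => ?_
    exact continuous_const.mul (continuous_eval_map_append 𝒲 g hg _ _)
  refine continuous_iff_continuousAt.2 fun x₀ => ?_
  rw [ContinuousAt, tendsto_iff_norm_sub_tendsto_zero]
  have hnorm : ∀ x, ‖φ x‖ = ‖of 𝒲 h𝒲 u‖ := fun x => norm_act _ _
  have hsq : ∀ x, ‖φ x - φ x₀‖ ^ 2 = 2 * ‖of 𝒲 h𝒲 u‖ ^ 2 - 2 * RCLike.re ⟪φ x, φ x₀⟫_ℂ := by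
    intro x
    rw [@norm_sub_sq ℂ, hnorm, hnorm]
    ring
  have hlim : Tendsto (fun x => ‖φ x - φ x₀‖ ^ 2) (𝓝 x₀) (𝓝 0) := by
    simp only [hsq]
    have h0 : 2 * ‖of 𝒲 h𝒲 u‖ ^ 2 - 2 * RCLike.re ⟪φ x₀, φ x₀⟫_ℂ = 0 := by
      rw [inner_self_eq_norm_sq, hnorm]; ring
    rw [← h0]
    exact ((RCLike.continuous_re.comp (hinner x₀)).tendsto x₀).const_mul 2 |>.const_sub _
  have : Tendsto (fun x => Real.sqrt (‖φ x - φ x₀‖ ^ 2)) (𝓝 x₀) (𝓝 (Real.sqrt 0)) :=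
    (Real.continuous_sqrt.tendsto 0).comp hlim
  simpa [Real.sqrt_sq (norm_nonneg _)] using this

/-- **Strong continuity from the free space to the Hilbert space** (isometries and density):
`x ↦ U(g x) ψ` is continuous for every `ψ ∈ H`. [folklore] -/
theorem continuous_U_apply {X : Type*} [TopologicalSpace X] (g : X → PoincareGroup d)
    (hg : ∀ (n : ℕ) (T : 𝓢((Fin n → SpaceTime d), ℂ)), Continuous fun x => poincareTestMulti n (g x) T)
    (ψ : GNSHilbert 𝒲 h𝒲) : Continuous fun x => U 𝒲 h𝒲 (g x) ψ := by
  refine continuous_of_uniform_approx_of_continuous fun s hs => ?_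
  obtain ⟨ε, hε, hεs⟩ := Metric.mem_uniformity_dist.1 hs
  obtain ⟨v, hv⟩ := denseRange_ι.exists_dist_lt ψ hε
  refine ⟨fun x => U 𝒲 h𝒲 (g x) (ι 𝒲 h𝒲 v), ?_, fun x => hεs ?_⟩
  · simp only [U_ι]
    exact (ι 𝒲 h𝒲).continuous.comp (continuous_act g hg v)
  · rw [dist_eq_norm, ← map_sub, LinearIsometryEquiv.norm_map, ← dist_eq_norm]
    exact hv

/-! ### Translations -/

/-- Pure translations act on multi-point test functions by `compSubConstCLM`. [folklore] -/
theorem poincareTestMulti_inl_eq (n : ℕ) (a : SpaceTime d) (T : 𝓢((Fin n → SpaceTime d), ℂ)) :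
    poincareTestMulti n (SemidirectProduct.inl (Multiplicative.ofAdd a) : PoincareGroup d) T =
      SchwartzMap.compSubConstCLM ℂ (fun _ : Fin n => a) T := by
  rw [poincareTestMulti_inl]
  rfl

/-- `a ↦ (translation by a) • T` is continuous into `𝒮`. [folklore] -/
theorem continuous_poincareTestMulti_inl (n : ℕ) (T : 𝓢((Fin n → SpaceTime d), ℂ)) :
    Continuous fun a : SpaceTime d =>
      poincareTestMulti n (SemidirectProduct.inl (Multiplicative.ofAdd a) : PoincareGroup d) T := by
  simp only [poincareTestMulti_inl_eq]
  exact (continuous_compSubConstCLM ℂ T).comp (continuous_pi fun _ => continuous_id)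

/-- **Strong continuity of the translations** `a ↦ U(a, 1) ψ` (Streater–Wightman (1964), §3-4,
proof of Thm. 3-7, continuity of `U(a, 1)` from the temperedness of the `𝒲ₙ`). [cite: StreaterWightman1964, §3-4] -/
theorem continuous_transl_apply (ψ : GNSHilbert 𝒲 h𝒲) :
    Continuous fun a : Multiplicative (SpaceTime d) => translHom 𝒲 h𝒲 a ψ := by
  have h := continuous_U_apply (h𝒲 := h𝒲)
    (fun a : SpaceTime d => (SemidirectProduct.inl (Multiplicative.ofAdd a) : PoincareGroup d))
    continuous_poincareTestMulti_inl ψ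
  exact h.comp continuous_toAdd

/-! ### Lorentz transformations -/

/-- Inversion is continuous on the restricted Lorentz group (operator-norm topology). [folklore] -/
theorem _root_.Literature.MathematicalPhysics.QuantumLattice.restrictedLorentzGroup.continuous_symm_coe :
    Continuous fun Λ : restrictedLorentzGroup d =>
      (((Λ : SpaceTime d ≃L[ℝ] SpaceTime d).symm : SpaceTime d ≃L[ℝ] SpaceTime d) :
        SpaceTime d →L[ℝ] SpaceTime d) := by
  have heq : (fun Λ : restrictedLorentzGroup d =>
      (((Λ : SpaceTime d ≃L[ℝ] SpaceTime d).symm : SpaceTime d ≃L[ℝ] SpaceTime d) :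
        SpaceTime d →L[ℝ] SpaceTime d)) =
      Ring.inverse ∘ fun Λ : restrictedLorentzGroup d =>
        ((Λ : SpaceTime d ≃L[ℝ] SpaceTime d) : SpaceTime d →L[ℝ] SpaceTime d) := by
    funext Λ
    simp only [Function.comp_apply]
    rw [show ((Λ : SpaceTime d ≃L[ℝ] SpaceTime d) : SpaceTime d →L[ℝ] SpaceTime d) =
        ((Λ : SpaceTime d ≃L[ℝ] SpaceTime d).toUnit : SpaceTime d →L[ℝ] SpaceTime d) from rfl,
      Ring.inverse_unit]
    rfl
  rw [heq]
  refine continuous_iff_continuousAt.2 fun Λ => ?_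
  refine ContinuousAt.comp ?_ restrictedLorentzGroup.continuous_coe.continuousAt
  exact NormedRing.inverse_continuousAt (Λ : SpaceTime d ≃L[ℝ] SpaceTime d).toUnit

/-- The diagonal extension `M ↦ (x ↦ (M x₁, …, M xₙ))` is `1`-Lipschitz in operator norm. [folklore] -/
theorem norm_lorentzDiag_sub_le (n : ℕ) (M M' : SpaceTime d ≃L[ℝ] SpaceTime d) :
    ‖(lorentzDiag n M : (Fin n → SpaceTime d) →L[ℝ] (Fin n → SpaceTime d)) - lorentzDiag n M'‖ ≤
      ‖(M : SpaceTime d →L[ℝ] SpaceTime d) - M'‖ := by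
  refine ContinuousLinearMap.opNorm_le_bound _ (norm_nonneg _) fun x => ?_
  rw [pi_norm_le_iff_of_nonneg (by positivity)]
  intro k
  change ‖M (x k) - M' (x k)‖ ≤ _
  calc ‖M (x k) - M' (x k)‖ = ‖((M : SpaceTime d →L[ℝ] SpaceTime d) - M') (x k)‖ := rfl
    _ ≤ ‖(M : SpaceTime d →L[ℝ] SpaceTime d) - M'‖ * ‖x k‖ := ContinuousLinearMap.le_opNorm _ _
    _ ≤ ‖(M : SpaceTime d →L[ℝ] SpaceTime d) - M'‖ * ‖x‖ := by gcongr; exact norm_le_pi_norm x k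

/-- Pure Lorentz transformations act on multi-point test functions by composition with the
diagonal inverse. [folklore] -/
theorem poincareTestMulti_inr_eq (n : ℕ) (Λ : restrictedLorentzGroup d)
    (T : 𝓢((Fin n → SpaceTime d), ℂ)) :
    poincareTestMulti n (SemidirectProduct.inr Λ : PoincareGroup d) T =
      SchwartzMap.compCLMOfContinuousLinearEquiv ℂ
        (lorentzDiag n (Λ : SpaceTime d ≃L[ℝ] SpaceTime d).symm) T := by
  ext x
  simp only [poincareTestMulti_apply, SemidirectProduct.right_inr, SemidirectProduct.left_inr,
    toAdd_one, sub_zero, SchwartzMap.compCLMOfContinuousLinearEquiv_apply, Function.comp_apply]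
  rfl

/-- `Λ ↦ Λ • T` is continuous into `𝒮` on the restricted Lorentz group. [folklore] -/
theorem continuous_poincareTestMulti_inr (n : ℕ) (T : 𝓢((Fin n → SpaceTime d), ℂ)) :
    Continuous fun Λ : restrictedLorentzGroup d =>
      poincareTestMulti n (SemidirectProduct.inr Λ : PoincareGroup d) T := by
  simp only [poincareTestMulti_inr_eq]
  refine SchwartzMap.continuous_compCLMOfContinuousLinearEquiv_apply ℂ _ ?_ T
  -- continuity of `Λ ↦ diag(Λ⁻¹)` in operator norm
  have h1 := restrictedLorentzGroup.continuous_symm_coe (d := d)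
  refine continuous_iff_continuousAt.2 fun Λ₀ => ?_
  rw [ContinuousAt, tendsto_iff_norm_sub_tendsto_zero]
  have h2 := tendsto_iff_norm_sub_tendsto_zero.1 (h1.tendsto Λ₀)
  exact squeeze_zero (fun _ => norm_nonneg _) (fun Λ => norm_lorentzDiag_sub_le n _ _) h2

/-- **Strong continuity of the Lorentz transformations** `Λ ↦ U(0, Λ) ψ`
(Streater–Wightman (1964), §3-4, proof of Thm. 3-7). [cite: StreaterWightman1964, §3-4] -/
theorem continuous_lor_apply (ψ : GNSHilbert 𝒲 h𝒲) :
    Continuous fun Λ : restrictedLorentzGroup d =>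
      (lorHom 𝒲 h𝒲 Λ : GNSHilbert 𝒲 h𝒲 →L[ℂ] GNSHilbert 𝒲 h𝒲) ψ :=
  continuous_U_apply (h𝒲 := h𝒲) (fun Λ : restrictedLorentzGroup d =>
    (SemidirectProduct.inr Λ : PoincareGroup d)) continuous_poincareTestMulti_inr ψ

/-! ### Temperedness of the fields -/

/-- The index map omitting the first position of the second block of `Fin (n + (m+1))`. [folklore] -/
def skipMid (n m : ℕ) : Fin (n + m) → Fin (n + (m + 1)) :=
  fun i => Fin.addCases (fun j : Fin n => Fin.castAdd (m + 1) j) (fun j : Fin m => Fin.natAdd n j.succ) i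

/-- `skipMid` on the first block. [folklore] -/
@[simp] theorem skipMid_left (n m : ℕ) (j : Fin n) :
    skipMid n m (Fin.castAdd m j) = Fin.castAdd (m + 1) j := by
  simp [skipMid]

/-- `skipMid` on the second block (shift by one). [folklore] -/
@[simp] theorem skipMid_right (n m : ℕ) (j : Fin m) :
    skipMid n m (Fin.natAdd n j) = Fin.natAdd n j.succ := by
  simp [skipMid]

/-- **Insertion of a one-point test function into a tensor monomial is a continuous linear map**:
`f ↦ a₁ ⊗ ⋯ ⊗ aₙ ⊗ f ⊗ b₁ ⊗ ⋯ ⊗ bₘ` (`SchwartzMap.mulCompCLM` with the tensor of the `aᵢ, bⱼ`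
in the remaining variables). [folklore] -/
def insertCLM {n m : ℕ} (a : Fin n → 𝓢(SpaceTime d, ℂ)) (b : Fin m → 𝓢(SpaceTime d, ℂ)) :
    𝓢(SpaceTime d, ℂ) →L[ℂ] 𝓢((Fin (n + (m + 1)) → SpaceTime d), ℂ) :=
  SchwartzMap.mulCompCLM (SchwartzMap.tensorFin (n + m) (Fin.append a b))
    (ContinuousLinearMap.proj (Fin.natAdd n (0 : Fin (m + 1))))
    (SchwartzMap.restrictCLM (skipMid n m)) ⟨1, fun x => by
      rw [one_mul, pi_norm_le_iff_of_nonneg (by positivity)]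
      intro i
      induction i using Fin.addCases with
      | left j =>
        refine le_trans ?_ (le_max_right _ _)
        have := norm_le_pi_norm (x ∘ skipMid n m) (Fin.castAdd m j)
        simpa using this
      | right j =>
        refine Fin.cases ?_ (fun j' => ?_) j
        · exact le_max_left _ _
        · refine le_trans ?_ (le_max_right _ _)
          have := norm_le_pi_norm (x ∘ skipMid n m) (Fin.natAdd n j')
          simpa using this⟩

/-- The insertion map produces the tensor monomial with the inserted factor. [folklore] -/
theorem insertCLM_apply {n m : ℕ} (a : Fin n → 𝓢(SpaceTime d, ℂ)) (b : Fin m → 𝓢(SpaceTime d, ℂ))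
    (f : 𝓢(SpaceTime d, ℂ)) :
    insertCLM a b f = SchwartzMap.tensorFin (n + (m + 1)) (Fin.append a (Fin.cons f b)) := by
  ext x
  rw [insertCLM, SchwartzMap.mulCompCLM_apply, SchwartzMap.tensorFin_apply,
    SchwartzMap.tensorFin_apply, Fin.prod_univ_add, Fin.prod_univ_add, Fin.prod_univ_succ]
  simp only [Fin.append_left, Fin.append_right, Fin.cons_zero, Fin.cons_succ,
    SchwartzMap.restrictCLM_apply, Function.comp_apply, skipMid_left, skipMid_right,
    ContinuousLinearMap.proj_apply]
  ring

/-- **Temperedness W1 of the reconstructed fields**: `f ↦ ⟪χ, φ_k(f) ψ⟫` is continuous on `𝒮`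
for `ψ, χ ∈ D₀` (a finite sum of the tempered distributions `𝒲ₙ` composed with insertion maps;
Streater–Wightman (1964), §3-4, proof of Thm. 3-7). [cite: StreaterWightman1964, §3-4] -/
theorem continuous_inner_fieldOp (k : κ) (ψ χ : dom 𝒲 h𝒲) :
    Continuous fun f : 𝓢(SpaceTime d, ℂ) =>
      ⟪(χ : GNSHilbert 𝒲 h𝒲), (fieldOp 𝒲 h𝒲 (k, f) ψ : GNSHilbert 𝒲 h𝒲)⟫_ℂ := by
  obtain ⟨v, rfl⟩ := ιr_surjective ψ
  obtain ⟨u, rfl⟩ := ιr_surjective χ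
  rw [← of_symm_eq v, ← of_symm_eq u]
  set v' := (of 𝒲 h𝒲).symm v
  set u' := (of 𝒲 h𝒲).symm u
  have hform : ∀ f : 𝓢(SpaceTime d, ℂ),
      ⟪((ιr 𝒲 h𝒲 (of 𝒲 h𝒲 u') : dom 𝒲 h𝒲) : GNSHilbert 𝒲 h𝒲),
        (fieldOp 𝒲 h𝒲 (k, f) (ιr 𝒲 h𝒲 (of 𝒲 h𝒲 v')) : GNSHilbert 𝒲 h𝒲)⟫_ℂ =
        ∑ l ∈ u'.support, ∑ l' ∈ v'.support, conj (u' l) * v' l' *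
          𝒲 ((WightmanData.starList l).length + (l'.length + 1))
            (Fin.append (wordLab (WightmanData.starList l)) (Fin.cons k (wordLab l')))
            (insertCLM (wordFn (WightmanData.starList l)) (wordFn l') f) := by
    intro f
    rw [fieldOp_ιr, coe_ιr, coe_ιr, inner_ι_ι, create_of, inner_def]
    simp only [LinearEquiv.symm_apply_apply]
    rw [← (Finsupp.mapDomain_id : Finsupp.mapDomain id u' = u'), innerFree_mapDomain,
      Finsupp.mapDomain_id]
    refine Finset.sum_congr rfl fun l _ => Finset.sum_congr rfl fun l' _ => ?_
    rw [id, pairing, eval_append_cons, insertCLM_apply]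
  simp only [hform]
  refine continuous_finsetSum _ fun l _ => continuous_finsetSum _ fun l' _ => ?_
  exact continuous_const.mul ((ContinuousLinearMap.continuous _).comp (insertCLM _ _).continuous)

end GNSSpace

end WightmanFamily

end Literature.Analysis.FunctionSpaces
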